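import Literature.NumberTheory.LFunctions.FordLemma46Smoothing
import Literature.NumberTheory.LFunctions.VinogradovKorobovFarZeros
import Literature.NumberTheory.LFunctions.VinogradovKorobovInputsProofs
import Literature.NumberTheory.LFunctions.VinogradovKorobovIntermediateDescent
import HarnessLib

/-!
# The zero inequalities and zero-free regions of Mossinghoff–Trudgian–Yang with Ford's smoothed detector discharged

Topic `Literature/NumberTheory/LFunctions`, family RH (explicit zero-free regions). Everything in
this file is PROVED; no named fact, no definition.

With Ford's Lemma 4.6 now a theorem for every admissible smoothing (`FordLemma46Smoothing.lean`:
`FordL46S.h42_raw`, `FordL46S.ford_lemma_4_6`), Patel's `|ζ(½ + it)| ≤ 66.7 t^{27/164}` a theorem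
(`zeta_half_line_patel_holds`, `VinogradovKorobovInputsProofs.lean`) and the far-zero bound
(6.4) = Ford's (9.2) at `η = ½` derived from (3.8) (`farZeroSum_half_strict_of_hsw_exp999`,
`VinogradovKorobovFarZeros.lean`), the in-tree assemblies of Mossinghoff–Trudgian–Yang
(arXiv:2212.06867) give:

* `zero_inequality_intermediate_of_hsw` — **Lemma 6.1** (the named fact
  `zero_inequality_intermediate_mossinghoff_trudgian_yang`) from **(3.8) alone**, i.e. from the named
  fact `zetaZeroCount_hasanalizade_shen_wong` (the Riemann–von Mangoldt formula of
  Hasanalizade–Shen–Wong);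
* `zero_free_region_intermediate_of_hsw` — **Theorem 1.4** (the named fact
  `zero_free_region_intermediate_mossinghoff_trudgian_yang`) from (3.8) alone;
* `zero_bound_large_height_of_ford_hsw_h45` — **the large-height region** (the named fact
  `zero_bound_large_height_mossinghoff_trudgian_yang`) from Ford's Richert-type bound
  `zeta_bound_ford` (named fact), (3.8), and MTY Lemma 4.5 as printed (hypothesis `h45`, constant
  `0.479`; see `VinogradovKorobovNearZeroCount.lean` and `FordLemma46Smoothing.lean` for why this
  printed constant is kept as a hypothesis: it rests on a step of Ford's Lemma 4.2 that Ford's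
  Lemma 3.1 does not cover).

## References

* M. J. Mossinghoff, T. S. Trudgian, A. Yang, *Explicit zero-free regions for the Riemann
  zeta-function*, Res. Number Theory 10 (2024), arXiv:2212.06867: Lemmas 4.5–4.7, 6.1, Theorems
  1.1–1.4. [MossinghoffTrudgianYangRNT2024]
* K. Ford, *Zero-free regions for the Riemann zeta function* (2002), arXiv:1910.08205: Lemma 4.6,
  (9.1)–(9.2), Theorem 1. [Ford2002Millennium]
-/

noncomputable section

namespace Literature.NumberTheory.LFunctions

/-- **MTY Lemma 6.1 from (3.8) alone**: `zero_inequality_intermediate_mossinghoff_trudgian_yang_of_ford`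
with `Far := FordFarZeroSumLT`, its detector hypothesis discharged by `FordL46S.fordDetectorIneqRaw`
and `FordL46S.fordK_one_le` (η = ½), Patel's bound by `zeta_half_line_patel_holds`, and (6.4) by
`farZeroSum_half_strict_of_hsw_exp999`. [cite: MossinghoffTrudgianYangRNT2024, Lemma 6.1] -/
theorem zero_inequality_intermediate_of_hsw (h38 : zetaZeroCount_hasanalizade_shen_wong) :
    zero_inequality_intermediate_mossinghoff_trudgian_yang :=
  zero_inequality_intermediate_mossinghoff_trudgian_yang_of_ford FordFarZeroSumLT
    (fun f D hf ↦ ⟨fun _ ht _ hS ↦ FordL46S.fordDetectorIneqRaw (by norm_num) le_rfl hf ht hS,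
      FordL46S.fordK_one_le hf (by norm_num) le_rfl⟩)
    zeta_half_line_patel_holds (farZeroSum_half_strict_of_hsw_exp999 h38)

/-- **MTY Theorem 1.4 (the intermediate-height zero-free region, as vendored) from (3.8) alone.**
[cite: MossinghoffTrudgianYangRNT2024, Theorem 1.4] -/
theorem zero_free_region_intermediate_of_hsw (h38 : zetaZeroCount_hasanalizade_shen_wong) :
    zero_free_region_intermediate_mossinghoff_trudgian_yang :=
  zero_free_region_intermediate_mossinghoff_trudgian_yang_of_ford FordFarZeroSumLT
    (fun f D hf ↦ ⟨fun _ ht _ hS ↦ FordL46S.fordDetectorIneqRaw (by norm_num) le_rfl hf ht hS,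
      FordL46S.fordK_one_le hf (by norm_num) le_rfl⟩)
    zeta_half_line_patel_holds (farZeroSum_half_strict_of_hsw_exp999 h38)

/-- **The large-height bound `zero_bound_large_height_mossinghoff_trudgian_yang` from Ford's
Richert-type bound, (3.8) and MTY Lemma 4.5 as printed** (`zero_bound_large_height_of_inputs'`
with Lemma 4.7 from `FordL46S.zero_inequality_mossinghoff_trudgian_yang_of_h45` and Lemma 6.1 from
`zero_inequality_intermediate_of_hsw`). [cite: MossinghoffTrudgianYangRNT2024, Theorem 1.1 and §5]
[cite: Ford2002Millennium, Theorem 1] -/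
theorem zero_bound_large_height_of_ford_hsw_h45 (hF : zeta_bound_ford)
    (h38 : zetaZeroCount_hasanalizade_shen_wong)
    (h45 : ∀ A B : ℝ, 1 < A → 0 < B → RichertBound A B → ∀ t u : ℝ, 100 ≤ t → 0 < u → u ≤ 1 / 4 →
      fordN t u ≤ 1.3478 * u ^ (3 / 2 : ℝ) * B * Real.log t + 0.479
        + (Real.log A - Real.log u + 2 / 3 * Real.log (Real.log t)) / 1.879) :
    zero_bound_large_height_mossinghoff_trudgian_yang :=
  zero_bound_large_height_of_inputs' hF
    (FordL46S.zero_inequality_mossinghoff_trudgian_yang_of_h45 h45 h38)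
    (zero_inequality_intermediate_of_hsw h38)

end Literature.NumberTheory.LFunctions
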